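import Summits.Ventures.PercRepro.S3SixWindow

/-!
# PercRepro — THE CELL STRUCTURE OF LEVEL `7` AT ONE RANK (p7 g23; an S4 feeder on p8's S3SixWindow)

`rls_seven_at_of_core`: for `p₀ ≥ 10`, level `7` at `p₀` for every finite matroid follows from level `6` at `p₀ − 1` (every
finite matroid) and the `e`-free core at `(p₀, d)` for every corank `d ≥ 8` — the coranks `d ≤ 6` have `U = ∅`, the corank `7`
is Theorem M (p8's `rls_succ_large_at 6 7 p₀`, verbatim the level-6 wrapper `rls_six_at_of_core` one level up). Nothing else is
claimed; no row is closed here by itself.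

* **`rls_seven_at_of_core`**.
Axioms: standard.
-/

open scoped Matroid

namespace PercRepro

namespace ThmN

variable {α : Type}

/-- **The cell structure of level `7` at one rank**: for `p₀ ≥ 10`, level `7` at `p₀` follows from level `6` at `p₀ − 1`
(every finite matroid) and the `e`-free core at `(p₀, d)` for every corank `d ≥ 8`. -/
theorem rls_seven_at_of_core (p₀ : ℕ) (hp : 10 ≤ p₀)
    (h6 : ∀ (M : Matroid α) [M.Finite], RLS M (p₀ - 1) 6)
    (hcore : ∀ (M : Matroid α) [M.Finite] (d : ℕ), 8 ≤ d → M.eRank = (p₀ : ℕ∞) → M.E.ncard = p₀ + d →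
      EFree M → RLS M p₀ 7) :
    ∀ (M : Matroid α) [M.Finite], RLS M p₀ 7 := by
  refine rls_succ_large_at (α := α) 6 7 p₀ (by omega) h6 ?_ ?_
  · intro M _ hn
    rcases Nat.lt_or_ge M.E.ncard (p₀ + 7) with h | h
    · exact RLS_of_ncard_lt M h
    · exact RLS_of_ncard_eq M (by omega)
  · intro M _ hR hbig hfree
    exact hcore M (M.E.ncard - p₀) (by omega) hR (by omega) hfree

end ThmN

end PercRepro
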